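import Literature.Computability.AlgebraicComplexity.BorderApolarityTests
import HarnessLib

/-!
# Perturbing an approximate decomposition to general position (border apolarity, `(2,1)`/`(1,2)`)

Topic `Literature/Computability/AlgebraicComplexity`.  Sibling of `BorderApolarityTests.lean`
(support for `Landsberg2005_borderRank_matMulTensor_two`): the general-position input of the
`(210)`/`(120)` tests of Conner–Harper–Landsberg 2023, §2.3 (ii) ("If the `r` points are in
general position, then `codim(I_{ijk,t}) = r` … we may choose the curves such that
`codim(I_{ijk}) = r`"), made explicit for the tree's algebraic border rank:

* `pertX`, `pertY`, `isApproxDecomposition_pert` — replacing two slots `x_ρ, y_ρ` of an order-`h`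
  approximate decomposition by `x_ρ + εᴺ e_{pa ρ}`, `y_ρ + εᴺ e_{pb ρ}` with `N > h` keeps it an
  order-`h` approximate decomposition of the same tensor;
* `finrank_I21_pert_add_le`, `finrank_I12_pert_add_le` — if the pairs `(pa ρ, pb ρ)` are distinct
  and `N` exceeds the degrees of all `x_ρ(a)`, `y_ρ(b)`, the perturbed points impose independent
  conditions on the symmetric `(2,1)`- and `(1,2)`-forms: `dim I₂₁₀ + r ≤ dim Sym`,
  `dim I₁₂₀ + r ≤ dim Sym` (the evaluation minors on the test vectors `e_{(pa j, pa j, pb j)}`,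
  `e_{(pa j, pb j, pb j)}` are `ε^{3N} · 1 +` lower order; `det_ne_zero_of_degree_lt`).

## References

* A. Conner, A. Harper, J. M. Landsberg, *New lower bounds for matrix multiplication and `det₃`*,
  Forum Math. Pi 11 (2023) e17 = arXiv:1911.07981, §2.3 (ii). [ConnerHarperLandsberg2023]
-/

noncomputable section

open scoped BigOperators Polynomial
open Polynomial

namespace Literature.Computability.AlgebraicComplexity

universe u v

section PerturbFile

variable {K : Type u} [Field K] (L : Type v) [Field L] [Algebra K[X] L]
variable {α β : Type} [Fintype α] [Fintype β]
variable {r : ℕ} (x : Fin r → α → K[X]) (y : Fin r → β → K[X])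

/-! ### Perturbation to general position -/

section Perturb

variable [DecidableEq α] [DecidableEq β] (pa : Fin r → α) (pb : Fin r → β) (N : ℕ)

/-- The perturbed first slot `x_ρ + εᴺ e_{pa ρ}`. [cite: ConnerHarperLandsberg2023, §2.3 (ii)] -/
def pertX : Fin r → α → K[X] := fun ρ a => x ρ a + X ^ N * if a = pa ρ then 1 else 0

/-- The perturbed second slot `y_ρ + εᴺ e_{pb ρ}`. [cite: ConnerHarperLandsberg2023, §2.3 (ii)] -/
def pertY : Fin r → β → K[X] := fun ρ b => y ρ b + X ^ N * if b = pb ρ then 1 else 0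

omit [Fintype α] [Fintype β] in
/-- Unfolding lemma for `pertX`. [folklore] -/
theorem pertX_apply (ρ : Fin r) (a : α) :
    pertX x pa N ρ a = x ρ a + X ^ N * if a = pa ρ then 1 else 0 := rfl

omit [Fintype α] [Fintype β] in
/-- Unfolding lemma for `pertY`. [folklore] -/
theorem pertY_apply (ρ : Fin r) (b : β) :
    pertY y pb N ρ b = y ρ b + X ^ N * if b = pb ρ then 1 else 0 := rfl

omit [Fintype α] [Fintype β] in
/-- **Perturbing by `εᴺ`, `N > h`, keeps an order-`h` approximate decomposition.**
[cite: ConnerHarperLandsberg2023, §2.3 (ii)] -/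
theorem isApproxDecomposition_pert {γ : Type} {t : γ → α → β → K} {h : ℕ} {z : Fin r → γ → K[X]}
    (hdec : IsApproxDecomposition h t z x y) (hN : h < N) :
    IsApproxDecomposition h t z (pertX x pa N) (pertY y pb N) := by
  intro c a b j hj
  have hsplit : ∑ ρ, z ρ c * pertX x pa N ρ a * pertY y pb N ρ b =
      ∑ ρ, z ρ c * x ρ a * y ρ b + X ^ N * ∑ ρ, z ρ c *
        (x ρ a * (if b = pb ρ then 1 else 0) + (if a = pa ρ then 1 else 0) * y ρ b +
          X ^ N * ((if a = pa ρ then 1 else 0) * if b = pb ρ then 1 else 0)) := by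
    rw [Finset.mul_sum, ← Finset.sum_add_distrib]
    refine Finset.sum_congr rfl fun ρ _ => ?_
    rw [pertX_apply, pertY_apply]
    ring
  rw [hsplit, coeff_add, coeff_X_pow_mul', if_neg (by omega), add_zero]
  exact hdec c a b j hj

variable {x y pa pb N}

omit [Fintype α] [Fintype β] [DecidableEq β] in
/-- Degree bound for the perturbed first slot. [folklore] -/
theorem natDegree_pertX_le (hx : ∀ ρ a, (x ρ a).natDegree < N) (ρ : Fin r) (a : α) :
    (pertX x pa N ρ a).natDegree ≤ N := by
  rw [pertX_apply]
  refine (natDegree_add_le _ _).trans (max_le (hx ρ a).le ?_)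
  split_ifs
  · rw [mul_one, natDegree_X_pow]
  · simp

omit [Fintype α] [Fintype β] [DecidableEq β] in
/-- Off the perturbed coordinate the first slot is unchanged. [folklore] -/
theorem pertX_of_ne {ρ : Fin r} {a : α} (ha : a ≠ pa ρ) : pertX x pa N ρ a = x ρ a := by
  rw [pertX_apply, if_neg ha, mul_zero, add_zero]

omit [Fintype α] [Fintype β] [DecidableEq α] in
/-- Degree bound for the perturbed second slot. [folklore] -/
theorem natDegree_pertY_le (hy : ∀ ρ b, (y ρ b).natDegree < N) (ρ : Fin r) (b : β) :
    (pertY y pb N ρ b).natDegree ≤ N := by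
  rw [pertY_apply]
  refine (natDegree_add_le _ _).trans (max_le (hy ρ b).le ?_)
  split_ifs
  · rw [mul_one, natDegree_X_pow]
  · simp

omit [Fintype α] [Fintype β] [DecidableEq α] in
/-- Off the perturbed coordinate the second slot is unchanged. [folklore] -/
theorem pertY_of_ne {ρ : Fin r} {b : β} (hb : b ≠ pb ρ) : pertY y pb N ρ b = y ρ b := by
  rw [pertY_apply, if_neg hb, mul_zero, add_zero]

omit [Fintype α] [Fintype β] in
/-- The diagonal of the `(2,1)` evaluation minor is `ε^{3N} +` lower order. [folklore] -/
theorem degree_diag21_lt (hx : ∀ ρ a, (x ρ a).natDegree < N) (hy : ∀ ρ b, (y ρ b).natDegree < N)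
    (hN : 0 < N) (ρ : Fin r) :
    (pertX x pa N ρ (pa ρ) ^ 2 * pertY y pb N ρ (pb ρ) - X ^ (3 * N)).degree < ((3 * N : ℕ) : WithBot ℕ) := by
  set p := x ρ (pa ρ)
  set q := y ρ (pb ρ)
  have hp : p.natDegree ≤ N - 1 := Nat.le_sub_one_of_lt (hx ρ _)
  have hq : q.natDegree ≤ N - 1 := Nat.le_sub_one_of_lt (hy ρ _)
  have e : pertX x pa N ρ (pa ρ) ^ 2 * pertY y pb N ρ (pb ρ) - X ^ (3 * N) =
      X ^ (2 * N) * q + 2 * p * X ^ (2 * N) + 2 * p * q * X ^ N + p ^ 2 * X ^ N + p ^ 2 * q := by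
    rw [pertX_apply, pertY_apply, if_pos rfl, if_pos rfl]
    ring
  rw [e]
  have hXn : ∀ n : ℕ, ((X : K[X]) ^ n).natDegree ≤ n := fun n => natDegree_X_pow_le n
  have h2 : (2 : K[X]).natDegree = 0 := natDegree_ofNat 2
  have hdeg : (X ^ (2 * N) * q + 2 * p * X ^ (2 * N) + 2 * p * q * X ^ N + p ^ 2 * X ^ N +
      p ^ 2 * q).natDegree ≤ 3 * N - 1 := by
    refine (natDegree_add_le _ _).trans (max_le ?_ ?_)
    refine (natDegree_add_le _ _).trans (max_le ?_ ?_)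
    refine (natDegree_add_le _ _).trans (max_le ?_ ?_)
    refine (natDegree_add_le _ _).trans (max_le ?_ ?_)
    · refine (natDegree_mul_le).trans ?_
      have := hXn (2 * N); omega
    · refine (natDegree_mul_le).trans ?_
      have := (natDegree_mul_le (p := (2 : K[X])) (q := p)); have := hXn (2 * N); omega
    · refine (natDegree_mul_le).trans ?_
      have h1 := (natDegree_mul_le (p := (2 : K[X]) * p) (q := q))
      have h2' := (natDegree_mul_le (p := (2 : K[X])) (q := p)); have := hXn N; omega
    · refine (natDegree_mul_le).trans ?_
      have := natDegree_pow_le (p := p) (n := 2); have := hXn N; omega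
    · refine (natDegree_mul_le).trans ?_
      have := natDegree_pow_le (p := p) (n := 2); omega
  refine (degree_le_natDegree).trans_lt ?_
  exact_mod_cast Nat.lt_of_le_of_lt hdeg (by omega)

omit [Fintype α] [Fintype β] in
/-- Off the diagonal the `(2,1)` evaluation minor has degree `< 3N`. [folklore] -/
theorem degree_off21_lt (hinj : Function.Injective fun ρ => (pa ρ, pb ρ))
    (hx : ∀ ρ a, (x ρ a).natDegree < N) (hy : ∀ ρ b, (y ρ b).natDegree < N) (hN : 0 < N)
    {ρ j : Fin r} (hρj : ρ ≠ j) :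
    (pertX x pa N ρ (pa j) ^ 2 * pertY y pb N ρ (pb j)).degree < ((3 * N : ℕ) : WithBot ℕ) := by
  have hne : pa j ≠ pa ρ ∨ pb j ≠ pb ρ := by
    by_contra h
    push Not at h
    exact hρj (hinj (Prod.ext h.1.symm h.2.symm))
  have hdeg : (pertX x pa N ρ (pa j) ^ 2 * pertY y pb N ρ (pb j)).natDegree ≤ 3 * N - 1 := by
    refine natDegree_mul_le.trans ?_
    have hpow := natDegree_pow_le (p := pertX x pa N ρ (pa j)) (n := 2)
    rcases hne with h | h
    · rw [pertX_of_ne h] at hpow ⊢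
      have h1 := hx ρ (pa j)
      have h2 := natDegree_pertY_le (pb := pb) hy ρ (pb j)
      have : (x ρ (pa j) ^ 2).natDegree ≤ 2 * (N - 1) := hpow.trans (by omega)
      omega
    · rw [pertY_of_ne h]
      have h1 := natDegree_pertX_le (pa := pa) hx ρ (pa j)
      have h2 := hy ρ (pb j)
      have : (pertX x pa N ρ (pa j) ^ 2).natDegree ≤ 2 * N := hpow.trans (by omega)
      omega
  refine (degree_le_natDegree).trans_lt ?_
  exact_mod_cast Nat.lt_of_le_of_lt hdeg (by omega)

omit [Fintype α] [Fintype β] in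
/-- The diagonal of the `(1,2)` evaluation minor is `ε^{3N} +` lower order. [folklore] -/
theorem degree_diag12_lt (hx : ∀ ρ a, (x ρ a).natDegree < N) (hy : ∀ ρ b, (y ρ b).natDegree < N)
    (hN : 0 < N) (ρ : Fin r) :
    (pertX x pa N ρ (pa ρ) * pertY y pb N ρ (pb ρ) ^ 2 - X ^ (3 * N)).degree < ((3 * N : ℕ) : WithBot ℕ) := by
  set p := x ρ (pa ρ)
  set q := y ρ (pb ρ)
  have hp : p.natDegree ≤ N - 1 := Nat.le_sub_one_of_lt (hx ρ _)
  have hq : q.natDegree ≤ N - 1 := Nat.le_sub_one_of_lt (hy ρ _)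
  have e : pertX x pa N ρ (pa ρ) * pertY y pb N ρ (pb ρ) ^ 2 - X ^ (3 * N) =
      X ^ (2 * N) * p + 2 * q * X ^ (2 * N) + 2 * q * p * X ^ N + q ^ 2 * X ^ N + q ^ 2 * p := by
    rw [pertX_apply, pertY_apply, if_pos rfl, if_pos rfl]
    ring
  rw [e]
  have hXn : ∀ n : ℕ, ((X : K[X]) ^ n).natDegree ≤ n := fun n => natDegree_X_pow_le n
  have hdeg : (X ^ (2 * N) * p + 2 * q * X ^ (2 * N) + 2 * q * p * X ^ N + q ^ 2 * X ^ N +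
      q ^ 2 * p).natDegree ≤ 3 * N - 1 := by
    refine (natDegree_add_le _ _).trans (max_le ?_ ?_)
    refine (natDegree_add_le _ _).trans (max_le ?_ ?_)
    refine (natDegree_add_le _ _).trans (max_le ?_ ?_)
    refine (natDegree_add_le _ _).trans (max_le ?_ ?_)
    · refine (natDegree_mul_le).trans ?_
      have := hXn (2 * N); omega
    · refine (natDegree_mul_le).trans ?_
      have := (natDegree_mul_le (p := (2 : K[X])) (q := q)); have := hXn (2 * N)
      have h2 : (2 : K[X]).natDegree = 0 := natDegree_ofNat 2; omega
    · refine (natDegree_mul_le).trans ?_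
      have h1 := (natDegree_mul_le (p := (2 : K[X]) * q) (q := p))
      have h2' := (natDegree_mul_le (p := (2 : K[X])) (q := q)); have := hXn N
      have h2 : (2 : K[X]).natDegree = 0 := natDegree_ofNat 2; omega
    · refine (natDegree_mul_le).trans ?_
      have := natDegree_pow_le (p := q) (n := 2); have := hXn N; omega
    · refine (natDegree_mul_le).trans ?_
      have := natDegree_pow_le (p := q) (n := 2); omega
  refine (degree_le_natDegree).trans_lt ?_
  exact_mod_cast Nat.lt_of_le_of_lt hdeg (by omega)

omit [Fintype α] [Fintype β] in
/-- Off the diagonal the `(1,2)` evaluation minor has degree `< 3N`. [folklore] -/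
theorem degree_off12_lt (hinj : Function.Injective fun ρ => (pa ρ, pb ρ))
    (hx : ∀ ρ a, (x ρ a).natDegree < N) (hy : ∀ ρ b, (y ρ b).natDegree < N) (hN : 0 < N)
    {ρ j : Fin r} (hρj : ρ ≠ j) :
    (pertX x pa N ρ (pa j) * pertY y pb N ρ (pb j) ^ 2).degree < ((3 * N : ℕ) : WithBot ℕ) := by
  have hne : pa j ≠ pa ρ ∨ pb j ≠ pb ρ := by
    by_contra h
    push Not at h
    exact hρj (hinj (Prod.ext h.1.symm h.2.symm))
  have hdeg : (pertX x pa N ρ (pa j) * pertY y pb N ρ (pb j) ^ 2).natDegree ≤ 3 * N - 1 := by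
    refine natDegree_mul_le.trans ?_
    have hpow := natDegree_pow_le (p := pertY y pb N ρ (pb j)) (n := 2)
    rcases hne with h | h
    · rw [pertX_of_ne h]
      have h1 := hx ρ (pa j)
      have h2 := natDegree_pertY_le (pb := pb) hy ρ (pb j)
      have : (pertY y pb N ρ (pb j) ^ 2).natDegree ≤ 2 * N := hpow.trans (by omega)
      omega
    · rw [pertY_of_ne h] at hpow ⊢
      have h1 := natDegree_pertX_le (pa := pa) hx ρ (pa j)
      have h2 := hy ρ (pb j)
      have : (y ρ (pb j) ^ 2).natDegree ≤ 2 * (N - 1) := hpow.trans (by omega)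
      omega
  refine (degree_le_natDegree).trans_lt ?_
  exact_mod_cast Nat.lt_of_le_of_lt hdeg (by omega)

/-- Evaluating `ev21` on a coordinate vector. [folklore] -/
theorem ev21_single (x' : Fin r → α → K[X]) (y' : Fin r → β → K[X]) (ρ : Fin r) (a₁ a₂ : α)
    (b₁ : β) : ev21 L x' y' ρ (Pi.single (a₁, a₂, b₁) 1) =
      polyVec L (x' ρ) a₁ * polyVec L (x' ρ) a₂ * polyVec L (y' ρ) b₁ := by
  rw [ev21_apply, Finset.sum_eq_single a₁, Finset.sum_eq_single b₁, Finset.sum_eq_single a₂]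
  · simp
  · intro a' _ h; simp [h]
  · simp
  · intro b _ h
    exact Finset.sum_eq_zero fun a' _ => by simp [h]
  · simp
  · intro a _ h
    exact Finset.sum_eq_zero fun b _ => Finset.sum_eq_zero fun a' _ => by simp [h]
  · simp

/-- Evaluating `ev12` on a coordinate vector. [folklore] -/
theorem ev12_single (x' : Fin r → α → K[X]) (y' : Fin r → β → K[X]) (ρ : Fin r) (a₁ : α)
    (b₁ b₂ : β) : ev12 L x' y' ρ (Pi.single (a₁, b₁, b₂) 1) =
      polyVec L (x' ρ) a₁ * polyVec L (y' ρ) b₁ * polyVec L (y' ρ) b₂ := by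
  rw [ev12_apply, Finset.sum_eq_single a₁, Finset.sum_eq_single b₁, Finset.sum_eq_single b₂]
  · simp
  · intro b' _ h; simp [h]
  · simp
  · intro b _ h
    exact Finset.sum_eq_zero fun b' _ => by simp [h]
  · simp
  · intro a _ h
    exact Finset.sum_eq_zero fun b _ => Finset.sum_eq_zero fun b' _ => by simp [h]
  · simp

variable [IsFractionRing K[X] L]

/-- **General position for `(2,1)` after perturbation**: `dim I₂₁₀ + r ≤ dim Sym` for the
perturbed points, if the pairs `(pa ρ, pb ρ)` are distinct and `N` exceeds all degrees (the
evaluation minor on the test vectors `e_{(pa j, pa j, pb j)}` is `ε^{3N} · 1 +` lower order).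
[cite: ConnerHarperLandsberg2023, §2.3 (ii)] -/
theorem finrank_I21_pert_add_le (hinj : Function.Injective fun ρ => (pa ρ, pb ρ))
    (hx : ∀ ρ a, (x ρ a).natDegree < N) (hy : ∀ ρ b, (y ρ b).natDegree < N) (hN : 0 < N) :
    Module.finrank L (I21 L (pertX x pa N) (pertY y pb N)) + r ≤
      Module.finrank L (symA L (α := α) (β := β)) := by
  refine finrank_I21_add_le L _ _ (fun j => Pi.single (pa j, pa j, pb j) 1) ?_ ?_
  · intro j a a' b
    by_cases h : (a, a', b) = (pa j, pa j, pb j)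
    · obtain ⟨rfl, rfl, rfl⟩ := Prod.mk.injEq _ _ _ _ ▸ h
      rfl
    · rw [Pi.single_eq_of_ne h, Pi.single_eq_of_ne]
      intro h'
      simp only [Prod.mk.injEq] at h h'
      exact h ⟨h'.2.1, h'.1, h'.2.2⟩
  · set M₀ : Matrix (Fin r) (Fin r) K[X] :=
      Matrix.of fun ρ j => pertX x pa N ρ (pa j) ^ 2 * pertY y pb N ρ (pb j) with hM₀
    have hmap : (Matrix.of fun ρ j => ev21 L (pertX x pa N) (pertY y pb N) ρ
        (Pi.single (pa j, pa j, pb j) 1)) = M₀.map (algebraMap K[X] L) := by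
      ext ρ j
      simp only [Matrix.of_apply, Matrix.map_apply, ev21_single, polyVec_apply, hM₀, map_mul, sq]
    rw [hmap, ← RingHom.mapMatrix_apply, ← RingHom.map_det,
      (IsFractionRing.injective K[X] L).ne_iff' (map_zero _)]
    refine det_ne_zero_of_degree_lt (3 * N) M₀ (fun ρ => ?_) (fun ρ j hρj => ?_)
    · exact degree_diag21_lt hx hy hN ρ
    · exact degree_off21_lt hinj hx hy hN hρj

/-- **General position for `(1,2)` after perturbation.** [cite: ConnerHarperLandsberg2023, §2.3 (ii)] -/
theorem finrank_I12_pert_add_le (hinj : Function.Injective fun ρ => (pa ρ, pb ρ))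
    (hx : ∀ ρ a, (x ρ a).natDegree < N) (hy : ∀ ρ b, (y ρ b).natDegree < N) (hN : 0 < N) :
    Module.finrank L (I12 L (pertX x pa N) (pertY y pb N)) + r ≤
      Module.finrank L (symB L (α := α) (β := β)) := by
  refine finrank_I12_add_le L _ _ (fun j => Pi.single (pa j, pb j, pb j) 1) ?_ ?_
  · intro j a b b'
    by_cases h : (a, b, b') = (pa j, pb j, pb j)
    · obtain ⟨rfl, rfl, rfl⟩ := Prod.mk.injEq _ _ _ _ ▸ h
      rfl
    · rw [Pi.single_eq_of_ne h, Pi.single_eq_of_ne]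
      intro h'
      simp only [Prod.mk.injEq] at h h'
      exact h ⟨h'.1, h'.2.2, h'.2.1⟩
  · set M₀ : Matrix (Fin r) (Fin r) K[X] :=
      Matrix.of fun ρ j => pertX x pa N ρ (pa j) * pertY y pb N ρ (pb j) ^ 2 with hM₀
    have hmap : (Matrix.of fun ρ j => ev12 L (pertX x pa N) (pertY y pb N) ρ
        (Pi.single (pa j, pb j, pb j) 1)) = M₀.map (algebraMap K[X] L) := by
      ext ρ j
      simp only [Matrix.of_apply, Matrix.map_apply, ev12_single, polyVec_apply, hM₀, map_mul, sq,
        mul_assoc]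
    rw [hmap, ← RingHom.mapMatrix_apply, ← RingHom.map_det,
      (IsFractionRing.injective K[X] L).ne_iff' (map_zero _)]
    refine det_ne_zero_of_degree_lt (3 * N) M₀ (fun ρ => ?_) (fun ρ j hρj => ?_)
    · exact degree_diag12_lt hx hy hN ρ
    · exact degree_off12_lt hinj hx hy hN hρj

end Perturb

end PerturbFile

end Literature.Computability.AlgebraicComplexity

end
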